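import Summits.ResolutionOfSingularities.ResolutionOfSingularities.Theorems.HilbertSamuelEliminationSigmaMaxModificationsCorridor3WLadderSegmentsHEmpBridge
import Summits.ResolutionOfSingularities.ResolutionOfSingularities.Theorems.HilbertSamuelEliminationSigmaMaxModificationsCorridor3WLadderSegmentsIso
import HarnessLib

/-!
# [OURS · L1 W4.2] COMPONENTS OF THE STRATUM MEETING THE NEAR LOCUS LIE IN IT; whole-part steps that meet the near locus are genuine
# (crux `SigmaMaxModifications` stmt-ResolutionOfSingularities-18506; conjunct `SigmaMaxModificationsCorridor3` stmt-…-19249; line `w_ladder`;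
# RECOGNITION-CUT (R5) = (H-emp), label side — first lemmas)

Stub worker res-L1-w42-stub-1 (gen 3). Helper file `--supports stmt-ResolutionOfSingularities-19249 --as helper`; kernel only, no named fact, no
new definition (universe `0`: closedness of `X(≥ ν)` over a field). At a base `b` isolated in its `ν`-stratum along a chain from a maximal origin:

* `Seg.subset_nearLocus_of_isIrreducible_of_meets` — **an IRREDUCIBLE subset of `X_{b+n}(ν)` meeting the near locus `N_n = φ_n⁻¹(x_b) ∩ X_{b+n}(ν)`
  lies inside it** (its generic point is in `X_{b+n}(ν)` by semicontinuity both ways, maps to a generization of `x_b` inside `X_b(ν)`, i.e. to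
  `x_b`; all its points then map into `closure {x_b} = {x_b}`); in particular every irreducible component of the stratum meeting `N_n` lies in
  `N_n` (`Seg.component_subset_nearLocus_of_meets`), so `N_n` is a union of components of `X_{b+n}(ν)`.
* `Seg.pt_mem_part_of_part_meets_nearLocus` — **if a label part `Y^{(j)}` meets `N_n` and `N_n` is IRREDUCIBLE, then the marked point `x_{b+n}`
  lies in `Y^{(j)}`** (the component carrying the meeting point IS `N_n ∋ x_{b+n}`): a step blowing up a whole label part (cycle start on a regular
  part, or cycle end) that meets the near locus is GENUINE — the irreducible-near-locus case of (R5).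

OURS bookkeeping; NOT a statement of the manuscript [Hironaka2017] nor of [CossartJannsenSaito2020]. AI-written; AI review is weaker than
expert review.

References: V. Cossart, U. Jannsen, S. Saito, LNM 2270 (2020), Rem. 6.29 (1), Def. 6.38 (iii), Thm. 2.33 [CossartJannsenSaito2020].
-/

noncomputable section

set_option linter.dupNamespace false -- namespace `…Corridor3.Moving` re-enters `…Corridor3` (module convention of the Moving files)

open CategoryTheory AlgebraicGeometry TopologicalSpace Topology IsLocalRing
open Literature.AlgebraicGeometry.Resolution Literature.RingTheory.HilbertSamuel
open Literature.AlgebraicGeometry.CossartJannsenSaito2020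
open Summit.ResolutionOfSingularities.ResolutionOfSingularities.Theorems.CampaignW42
open Summit.ResolutionOfSingularities.ResolutionOfSingularities.Theorems.SigmaMaxModificationsCorridor3.Helpers
open Summit.ResolutionOfSingularities.ResolutionOfSingularities.Theorems.SigmaMaxModifications.Sketch

namespace Summit.ResolutionOfSingularities.ResolutionOfSingularities.Theorems.SigmaMaxModificationsCorridor3.Moving.Seg

variable {R : ∀ S : Scheme.{0}, CentreSeq S → Prop} {N : ℕ} {ν : ℕ → ℕ} {k : Type} [Field k]
  {c : ℕ → MarkedStage.{0}} (hc : ∀ n, CanonicalNearStep R N ν (c n) (c (n + 1))) (hRa : OracleAdmissible R)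
  (hν : ν ≠ iterPSum N Phi) (h0 : Helpers.CycleInv k N ν (c 0))
  {p : ℕ} {X : Scheme.{0}} [IsLocallyNoetherian X] {x : X} (hX : IsMaximalOrigin p N ν X x)
  (hreach : Reaches R N ν (MarkedStage.init X x) (c 0))

/-- `X(≥ ν)` is closed at every stage carrying the cycle invariant (upper semicontinuity over a field). [cite: CossartJannsenSaito2020, Thm. 2.33] -/
theorem isClosed_hsStratumGE_of_cycleInv {s : MarkedStage.{0}} (h : Helpers.CycleInv k N ν s) (μ : ℕ → ℕ) :
    IsClosed (Scheme.hsStratumGE s.W N μ) := by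
  obtain ⟨⟨f, hft, hqc⟩, -, hdim, -⟩ := h
  haveI : IsLocallyNoetherian s.W := s.ln
  exact (stub_isClosed_hsMaxLocus_over_field stub_hsFun_le_of_specializes_over_field k s.W f hft hqc N hdim).1 μ

include hX hreach in
/-- **AN IRREDUCIBLE SUBSET OF `X_{b+n}(ν)` MEETING THE NEAR LOCUS OVER `x_b` LIES INSIDE IT** (base isolated in its stratum).
[cite: CossartJannsenSaito2020, Def. 6.38 (iii), Thm. 2.33] -/
theorem subset_nearLocus_of_isIrreducible_of_meets (b : ℕ)
    (hU : ∃ U : Set (c b).W, IsOpen U ∧ (c b).pt ∈ U ∧ U ∩ Scheme.hsStratum (c b).W N ν ⊆ {(c b).pt}) (n : ℕ) {E : Set (c (b + n)).W}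
    (hE : IsIrreducible E) (hEsub : E ⊆ Scheme.hsStratum (c (b + n)).W N ν)
    (hmeet : (E ∩ (upTower hc hRa hν h0 b).nearLocus N (c b).pt n).Nonempty) :
    E ⊆ (upTower hc hRa hν h0 b).nearLocus N (c b).pt n := by
  have hcyc : Helpers.CycleInv k N ν (c (b + n)) := cycleInv_at hc hRa hν h0 (b + n)
  obtain ⟨z₀, hz₀E, hz₀N⟩ := hmeet
  -- the generic point `η` of the closure of `E`
  set η := hE.genericPoint with hη
  have hgen : IsGenericPoint η (closure E) := hE.isGenericPoint_genericPoint_closure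
  have hspec : ∀ z ∈ E, η ⤳ z := fun z hz => hgen.specializes (subset_closure hz)
  -- `η ∈ X_{b+n}(ν)`: `H(η) ≤ H(z₀) = ν` along `η ⤳ z₀`, and `η ∈ closure E ⊆ X(≥ ν)`
  have hνz₀ : Scheme.hsFun (c (b + n)).W N z₀ = ν := Scheme.mem_hsStratum_iff.mp (hEsub hz₀E)
  have hle : Scheme.hsFun (c (b + n)).W N η ≤ ν := hνz₀ ▸ hsFun_le_of_specializes_of_cycleInv hcyc (hspec z₀ hz₀E)
  have hge : ν ≤ Scheme.hsFun (c (b + n)).W N η := by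
    have hcl : closure E ⊆ Scheme.hsStratumGE (c (b + n)).W N ν :=
      closure_minimal (fun z hz => Scheme.hsStratum_subset_hsStratumGE N ν (hEsub hz)) (isClosed_hsStratumGE_of_cycleInv hcyc ν)
    exact Scheme.mem_hsStratumGE_iff.mp (hcl hgen.mem)
  have hηstr : η ∈ Scheme.hsStratum (c (b + n)).W N ν := Scheme.mem_hsStratum_iff.mpr (le_antisymm hle hge)
  -- `φ_n(η)` generizes `φ_n(z₀) = x_b`, so `η ∈ N_n` and `φ_n(η) = x_b`
  have hηN : η ∈ (upTower hc hRa hν h0 b).nearLocus N (c b).pt n :=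
    mem_nearLocus_of_mem_hsStratum_of_specializes hc hRa hν h0 hX hreach b hU n η hηstr
      (hz₀N.1 ▸ (hspec z₀ hz₀E).map ((upTower hc hRa hν h0 b).phi n).continuous)
  -- every point of `E` maps into `closure {x_b} = {x_b}`
  have hclosed : IsClosed ({(c b).pt} : Set (c b).W) := Reaches.isClosed_pt hX.isClosed (reaches_chain hreach hc b)
  intro z hz
  have hsp : (c b).pt ⤳ ((upTower hc hRa hν h0 b).phi n).base z :=
    hηN.1 ▸ (hspec z hz).map ((upTower hc hRa hν h0 b).phi n).continuous
  have hφz : ((upTower hc hRa hν h0 b).phi n).base z = (c b).pt := by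
    have := hsp.mem_closed hclosed (Set.mem_singleton _)
    exact this
  refine ⟨hφz, ?_⟩
  show Scheme.hsFun (c (b + n)).W N z = Scheme.hsFun (c b).W N (c b).pt
  rw [Scheme.mem_hsStratum_iff.mp (hEsub hz),
    Scheme.mem_hsStratum_iff.mp (pt_mem_hsStratum_of_reaches hX.mem_stratum (reaches_chain hreach hc b))]

include hX hreach in
/-- **Every irreducible component of `X_{b+n}(ν)` meeting the near locus over `x_b` lies in it**: the near locus is a union of components of the
stratum. [cite: CossartJannsenSaito2020, Def. 6.38 (iii), Rem. 6.29 (1)] -/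
theorem component_subset_nearLocus_of_meets (b : ℕ)
    (hU : ∃ U : Set (c b).W, IsOpen U ∧ (c b).pt ∈ U ∧ U ∩ Scheme.hsStratum (c b).W N ν ⊆ {(c b).pt}) (n : ℕ) {Z : Set (c (b + n)).W}
    (hZ : Z ∈ componentsIn (Scheme.hsStratum (c (b + n)).W N ν))
    (hmeet : (Z ∩ (upTower hc hRa hν h0 b).nearLocus N (c b).pt n).Nonempty) :
    Z ⊆ (upTower hc hRa hν h0 b).nearLocus N (c b).pt n :=
  subset_nearLocus_of_isIrreducible_of_meets hc hRa hν h0 hX hreach b hU n (componentsIn.isIrreducible hZ) (componentsIn.subset hZ) hmeet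

include hX hreach in
/-- **A LABEL PART MEETING AN IRREDUCIBLE NEAR LOCUS CONTAINS THE MARKED POINT**: if `Y_{b+n}^{(j)} ∩ N_n ≠ ∅` and `N_n` is irreducible, then
`x_{b+n} ∈ Y_{b+n}^{(j)}` — the component of the stratum carrying the meeting point lies in `N_n`, and by maximality IS the component containing
`N_n`, hence contains `x_{b+n} ∈ N_n`. So a canonical step whose centre is a whole label part and which meets the near locus is GENUINE.
[cite: CossartJannsenSaito2020, Rem. 6.29 (1), Def. 6.38 (iii)] -/
theorem pt_mem_part_of_part_meets_nearLocus (b : ℕ)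
    (hU : ∃ U : Set (c b).W, IsOpen U ∧ (c b).pt ∈ U ∧ U ∩ Scheme.hsStratum (c b).W N ν ⊆ {(c b).pt}) (n : ℕ)
    (hirr : IsIrreducible ((upTower hc hRa hν h0 b).nearLocus N (c b).pt n)) {j : ℕ}
    (hmeet : ((c (b + n)).L.part (Scheme.hsStratum (c (b + n)).W N ν) j ∩ (upTower hc hRa hν h0 b).nearLocus N (c b).pt n).Nonempty) :
    (c (b + n)).pt ∈ (c (b + n)).L.part (Scheme.hsStratum (c (b + n)).W N ν) j := by
  obtain ⟨z, hzP, hzN⟩ := hmeet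
  obtain ⟨Z, hZ, hlab, hzZ⟩ := ((c (b + n)).L.mem_part_iff _ j z).mp hzP
  -- the component `Z` lies in the near locus; the near locus lies in SOME component `Z₀`; maximality: `Z₀ ⊆ Z`
  have hZN : Z ⊆ (upTower hc hRa hν h0 b).nearLocus N (c b).pt n :=
    component_subset_nearLocus_of_meets hc hRa hν h0 hX hreach b hU n hZ ⟨z, hzZ, hzN⟩
  have hNsub : (upTower hc hRa hν h0 b).nearLocus N (c b).pt n ⊆ Scheme.hsStratum (c (b + n)).W N ν := by
    intro w hw
    refine Scheme.mem_hsStratum_iff.mpr ?_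
    have h2 : Scheme.hsFun (c (b + n)).W N w = Scheme.hsFun (c b).W N (c b).pt := hw.2
    rw [h2]
    exact Scheme.mem_hsStratum_iff.mp (pt_mem_hsStratum_of_reaches hX.mem_stratum (reaches_chain hreach hc b))
  obtain ⟨-, -, hmax⟩ := mem_componentsIn_iff.mp hZ
  have hNZ : (upTower hc hRa hν h0 b).nearLocus N (c b).pt n ⊆ Z := hmax _ hNsub hirr hZN
  -- the marked point is a near point
  have hptN : (c (b + n)).pt ∈ (upTower hc hRa hν h0 b).nearLocus N (c b).pt n := by
    refine ⟨upTower_phi_pt hc hRa hν h0 b n, ?_⟩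
    show Scheme.hsFun (c (b + n)).W N (c (b + n)).pt = Scheme.hsFun (c b).W N (c b).pt
    rw [Scheme.mem_hsStratum_iff.mp (pt_mem_hsStratum_of_reaches hX.mem_stratum (reaches_chain hreach hc (b + n))),
      Scheme.mem_hsStratum_iff.mp (pt_mem_hsStratum_of_reaches hX.mem_stratum (reaches_chain hreach hc b))]
  exact ((c (b + n)).L.mem_part_iff _ j _).mpr ⟨Z, hZ, hlab, hNZ hptN⟩

end Summit.ResolutionOfSingularities.ResolutionOfSingularities.Theorems.SigmaMaxModificationsCorridor3.Moving.Seg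

end
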